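import Summits.CriticalPhenomena.PercolationContinuityZ3.Theorems.PercNearOneGluingNoHeavyLowerTailSahiCombTriWFibreThreeCert

/-!
# `TRI_W(a) ≥ 0` for EVERY index cube when the fibre cube has dimension three, II: the upper half of the check and the theorem

Support file of the one-cut programme (crux `NoHeavyLowerTail`, stmt-CriticalPhenomena-4575; cell `prim-masterthm`, seat P5 gen 23;
memo `FROM-prim-masterthm-p5-g23-PAIR-LOCAL.md`).  Target of the lane: `FiveUpSet.TriWIneq` (`…SahiCombTriWGeneral`, OPEN for `a ≥ 2` in general).

By the PAIR-LOCAL PRINCIPLE (`…SahiCombTriWPairLocal`: `triW_nonneg_of_pairLocalCert`) it suffices, for the fibre cube `W = Finset (Fin 3)` and a test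
up-set `P ⊆ W`, to exhibit `c > 0` and a weight `κ_P : W → W → ℕ` with the ONE-CUBE inequality
`Σ_{u,e} κ_P(u,e)·([u∈F]−[u∈F'])·([e∈G]−[e∈G']) ≤ c · triWOne P F F' G G'` for all up-sets `F, F', G, G'` of `W` (`PairLocalCert P c κ_P`).
The weights below were found by an exact LP with row generation over all `20⁴ = 160000` quadruples of up-sets (kit j163969, code23/loc4) and verified
there in integer arithmetic; here they are re-checked inside Lean by ONE evaluation of a closed Boolean term (`native_decide`), after transporting
the whole statement to the 8-point model `Fin 8` of the cube `Finset (Fin 3)` (point `s ↦ Σ_{i∈s} 2^i`, complement `↦ Fin.rev`) where finset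
arithmetic is cheap.  Shape of the certificates: `c = 4`, total weight `Σ κ_P = 4·#P` (forced by the rows `(W,∅,W,∅)`, `(∅,W,W,∅)`), supported on `P × P`;
e.g. `P = W \ {∅}`: `κ/2 = δ_(1,1)+δ_(3,3)+δ_(4,5)+δ_(5,4)+δ_(6,6)+2δ_(7,7)` (points as 3-bit masks).

* (objects — transport `pt8`, weights `kapList3`/`kap3`, rows `row8`, lower half `plc8_lo` — are in `…SahiCombTriWFibreThreeCert`);
* `FiveUpSet.plc8_hi` — the rows of the 10 test up-sets with family mask `> 224` (computational, `native_decide`); `plc8_all` — all `20 × 20⁴` rows;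
* **`FiveUpSet.pairLocalCert_fin_three`** — `PairLocalCert P 4 (kap3 P)` for every up-set `P` of `Finset (Fin 3)`;
* **`FiveUpSet.triW_nonneg_fin_three`** — `0 ≤ triW P F G` for `γ = Fin 3`, EVERY up-set `P`, EVERY finite index type `β` and all monotone families of
  up-sets: `TriWIneq` on every cell `(a, 3)` (census had reached `a ≤ 3` at `n = 3`; with `…TriWFibreTwo` (n = 2) and the thin edge this settles every
  cell with `n ≤ 3`, all `a`).
HONEST LABEL: the reduction is proved in `…TriWPairLocal` (std axioms); the certificate check here is COMPUTATIONAL (`native_decide`, axiom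
`Lean.ofReduceBool`); `TriWIneq` for `n ≥ 4` stays OPEN (pair-local certificates with point-gap weights exist for 23 of the 24 classes of up-sets of
`2^4` — kit j163638, exact on all `168⁴` rows — and do NOT exist for `P = K₂₂ = (x₀∨x₁)(x₂∨x₃)`, kit j163935). [this work]
-/

namespace Summit.CriticalPhenomena.PercolationContinuityZ3.Theorems

namespace FiveUpSet

open Finset

/-- **The finite check, upper half** (computational, `native_decide`): every certificate row for the 10 test up-sets with family mask `> 224`. [this work] -/
theorem plc8_hi : ∀ Q ∈ ups8.filter (fun Q => 224 < m8 Q), ∀ A ∈ ups8, ∀ A' ∈ ups8, ∀ B ∈ ups8, ∀ B' ∈ ups8,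
    row8 Q A A' B B' = true := by
  native_decide

/-- **The finite check**: all `20 × 20⁴` rows pass. [this work] -/
theorem plc8_all : ∀ Q ∈ ups8, ∀ A ∈ ups8, ∀ A' ∈ ups8, ∀ B ∈ ups8, ∀ B' ∈ ups8, row8 Q A A' B B' = true := by
  intro Q hQ
  by_cases h : m8 Q ≤ 224
  · exact plc8_lo Q (mem_filter.2 ⟨hQ, h⟩)
  · exact plc8_hi Q (mem_filter.2 ⟨hQ, lt_of_not_ge h⟩)

/-! ### Back to `Finset (Fin 3)`: the certificates and the theorem -/

/-- **Pair-local certificates for every up-set of `2^3`.** [this work] -/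
theorem pairLocalCert_fin_three (P : Finset (Finset (Fin 3))) (hP : IsUpperSet (P : Set (Finset (Fin 3)))) :
    PairLocalCert P 4 (kap3 P) := by
  intro F F' G G' hF hF' hG hG'
  have h := plc8_all _ (map_mem_ups8 hP) _ (map_mem_ups8 hF) _ (map_mem_ups8 hF') _ (map_mem_ups8 hG) _ (map_mem_ups8 hG')
  unfold row8 at h
  have h' := of_decide_eq_true h
  rw [LatticeFiveUpSet.triWOne_map (complEquiv (Fin 3)) Fin.revPerm pt8.toEmbedding pt8_compl] at h'
  -- reindex the double sum along `pt8`
  have hL : ∑ u : Finset (Fin 3), ∑ e : Finset (Fin 3), (kap3 P u e : ℤ) * sgnDiff F F' u * sgnDiff G G' e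
      = ∑ i : Fin 8, ∑ j : Fin 8, (kap3Tab (m8 (P.map pt8.toEmbedding)) i j : ℤ)
          * sgnDiff8 (F.map pt8.toEmbedding) (F'.map pt8.toEmbedding) i * sgnDiff8 (G.map pt8.toEmbedding) (G'.map pt8.toEmbedding) j := by
    refine Fintype.sum_equiv pt8 _ _ fun u => ?_
    refine Fintype.sum_equiv pt8 _ _ fun e => ?_
    unfold kap3
    rw [sgnDiff_map F F' u, sgnDiff_map G G' e]
  rw [hL]
  unfold kap3Tab
  rw [sum_sum_listMult]
  exact_mod_cast h'

variable {β : Type} [DecidableEq β] [Fintype β]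

/-- **`TriWIneq` on every cell `(a, 3)`**: for the fibre cube `Finset (Fin 3)`, EVERY up-set `P`, EVERY finite index type `β` and all monotone
families `F, G` of up-sets, `0 ≤ triW P F G`.  Proof: the pair-local principle with the certificates `kap3`. [this work] -/
theorem triW_nonneg_fin_three (P : Finset (Finset (Fin 3))) (hP : IsUpperSet (P : Set (Finset (Fin 3))))
    (F G : Finset β → Finset (Finset (Fin 3)))
    (hF : ∀ x, IsUpperSet (F x : Set (Finset (Fin 3)))) (hG : ∀ x, IsUpperSet (G x : Set (Finset (Fin 3))))
    (hFm : Monotone F) (hGm : Monotone G) :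
    0 ≤ triW P F G :=
  triW_nonneg_of_pairLocalCert (by norm_num) (pairLocalCert_fin_three P hP) F G hF hG hFm hGm

end FiveUpSet

end Summit.CriticalPhenomena.PercolationContinuityZ3.Theorems
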